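import Summits.BirchSwinnertonDyer.BirchSwinnertonDyer.Theorems.KimAtThreeFineKatoSemiLocalLatticeInt
import Literature.NumberTheory.AdelicBaseChange.PadicTensorCompletionTraceProofs
import Mathlib.RingTheory.DedekindDomain.Different
import HarnessLib

/-!
# Route `KimAtThreeKolyvagin` (W2), the deep leaf's UNIFORM road (clause X1-int): the lattice
# `L_int′(m) = ℤ_p⟨1 ⊗ 𝓞_{ℚ(ζ_m)}⟩ ⊂ ℚ_p ⊗ ℚ(ζ_m)` is SELF-DUAL for the trace when `p ∤ m`

Cell `bsd-addord`, seat `bsd-addord-w2-acc3` (PROGRAMME PART 1b row (3), gen 5);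
`--supports stmt-BirchSwinnertonDyer-19679` (helper).  TOOL theorems only (no definition, no named fact,
no `sorry`); nothing is asserted about any curve; closes nothing; nothing booked.

WHY.  On the road of record for the deep leaf (19075 / 19679 / 19076 / 19562 BY NAME ⟸ four leaves
∧ (C1ᵤ) ⟸ (C1ₑₓ), seats w2-c2 g7 / w2-c3 g7) the one displayed integrality clause X1-int_b
«`∃ l ∈ L_int, 3^b·(φ(h) ⊗ 1 − Λ_{0,r} y) = 3^{j+1}·l`» is, for Kato's `Λ = Σ_w ι_w ∘ exp*_w ∘ loc_w`,
discharged per factor `w ∣ 3` of `ℚ(ζ_m)` by the [BK90]/Tate-duality PAIRING integrality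
`Tr_{K_w/ℚ₃}(exp*_ω(x)·log_ω(P)) ∈ ℤ₃` and the K-port's `log_ω(E₁(K_w)) = 3𝒪_w`; these give only
`3·exp*_ω(H¹(K_w,T)) ⊆ 𝒪_w^∨` (trace dual).  To land in `𝒪_w` itself — equivalently, after seat
w2-acc4's `Ψ : ℚ_p ⊗ ℚ(ζ_m) ≃ ∏_w K_w` (`L_int′ ↔ ∏ 𝒪_w`, `Tr = Σ_w Tr_w`), in `L_int′(m)` — one
needs the purely algebraic fact proved here: **for `p ∤ m` the trace dual of `L_int′(m)` is
`L_int′(m)`** (the discriminant of `ℚ(ζ_m)` is a `p`-adic unit).  The proof avoids discriminant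
formulas and `𝓞 = ℤ[ζ]` (in Mathlib for prime powers only): from `X^m − 1 = Φ_m·Q` one gets
`m = ζ·Φ_m′(ζ)·Q(ζ)`, so `m/Φ_m′(ζ) ∈ ℤ[ζ]`; Mathlib's `traceForm_dualSubmodule_adjoin`
(`ℤ[ζ]^∨ = Φ_m′(ζ)⁻¹·ℤ[ζ]`) then gives `m·ℤ[ζ]^∨ ⊆ ℤ[ζ] ⊆ 𝓞`; base change to `ℚ_p` by the dual
basis of the power basis; finally `m ∈ ℤ_pˣ`.

* §1 `exists_natCast_eq_aeval_derivative_mul` — `m = Φ_m′(ζ)·q`, `q ∈ ℤ[ζ]`; `aeval_derivative_minpoly_ne_zero`.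
* §2 `exists_natCast_mul_eq_of_forall_trace_mul_mem` — `y ∈ ℚ(ζ_m)` with `Tr(y·z) ∈ ℤ` for all
  `z ∈ ℤ[ζ]` has `m·y ∈ ℤ[ζ]`; `toSubmodule_adjoin_eq_span_range_basis` (`ℤ[ζ] = ℤ⟨ζ^i⟩`);
  `exists_natCast_mul_traceDual_eq` (`m·d_i ∈ ℤ[ζ]` for the trace-dual basis `d` of `{ζ^i}`).
* §3 `natCast_smul_mem_span_ringOfIntegers_of_norm_trace_mul_le_one` (any `m`) and
  ★ `mem_span_ringOfIntegers_of_norm_trace_mul_le_one` (`p ∤ m`): `a ∈ ℚ_p ⊗ ℚ(ζ_m)` with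
  `‖Tr(a·(1 ⊗ b))‖ ≤ 1` for all `b ∈ 𝓞` lies in `L_int′(m)`;
  `mem_span_ringOfIntegers_iff_forall_norm_trace_mul_le_one` — self-duality (with w2-acc4's converse
  `norm_trace_le_one_of_mem_span_ringOfIntegers`).
* §4 `symm_mem_span_ringOfIntegers_of_forall_trace_mul_mem` — per-factor form along w2-acc4's `Ψ`:
  a family `(y_w)_{w∣p}` with each `y_w ∈ 𝒪_w^∨` has `Ψ⁻¹ y ∈ L_int′(m)` (so `𝒪_w^∨ = 𝒪_w`).

HONEST LIMITS: `p ∤ m` only (at levels divisible by `p` the lattice is NOT self-dual and the clause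
X1-int needs `b ≥ 2`); nothing here mentions `exp*`, a curve, or a cohomology class — the duality
PAIRING integrality over `K_w` ([BK90] 3.8 + local Tate duality, a cite item in the `exp*_ω`
currency of `defn-EllipticNeronDeRhamClass`) and `log_ω(E₁(K_w)) = 3𝒪_w` (K-port, landed) are the
other two inputs of the crude bound `3·exp*_ω(H¹(K_w,T)) ⊆ 𝒪_w`, assembled elsewhere.

References: [Kato2004Asterisque] Thm. 9.7, Ex. 13.3 (the semi-local `exp*` on `H¹(ℤ[ζ_m, 1/p], T)`);
[Kim2022StructureSelmer] §3.4.1 and the proof of Thm. 3.13; [BlochKato1990] Prop. 3.8;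
J. Neukirch, *Algebraic Number Theory*, III (2.4), (2.9) (trace dual of a monogenic order = `f′(α)⁻¹·𝒪`,
unramified ⇒ different trivial) [folklore].
-/

set_option autoImplicit false
-- the Theorems namespace of a single-conjunct summit repeats the summit name by design (D-0017)
set_option linter.dupNamespace false
-- `CyclotomicField m ℚ`'s two `ℚ`-algebra structures (splitting field / `DivisionRing.toRatAlgebra`) agree only
-- up to unfolding, as in the sibling files `KimAtThreePortSharedSATCore`, `KimAtThreeFineKatoSemiLocalLattice*`
set_option backward.isDefEq.respectTransparency false

noncomputable section

open scoped TensorProduct NumberField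
open NumberField Polynomial IsDedekindDomain
open Summit.BirchSwinnertonDyer.BirchSwinnertonDyer.Theorems.KimAtThreePortSharedSATCore

namespace Summit.BirchSwinnertonDyer.BirchSwinnertonDyer.Theorems.KimAtThreeSemiLocalTraceDual

variable (m : ℕ) [NeZero m]

/-! ### §1 `m / Φ_m′(ζ_m) ∈ ℤ[ζ_m]` -/

/-- **`m = Φ_m′(ζ)·q` with `q ∈ ℤ[ζ]`** for a primitive `m`-th root of unity `ζ` in a field of
characteristic `0`: differentiate `X^m − 1 = Φ_m·Q` (`Q ∈ ℤ[X]`) and evaluate at `ζ`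
(`mζ^{m−1} = Φ_m′(ζ)Q(ζ)`, and `ζ^{m−1}·ζ = 1`); here `Φ_m = minpoly ℚ ζ`. [folklore] -/
theorem exists_natCast_eq_aeval_derivative_mul {K : Type*} [Field K] [CharZero K]
    {ζ : K} (hζ : IsPrimitiveRoot ζ m) :
    ∃ q ∈ Algebra.adjoin ℤ {ζ}, (m : K) = aeval ζ (derivative (minpoly ℚ ζ)) * q := by
  have hm : 0 < m := Nat.pos_of_ne_zero (NeZero.ne m)
  obtain ⟨Q, hQ⟩ := cyclotomic.dvd_X_pow_sub_one m ℤ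
  -- `Φ_m′(ζ)` computed from the integral cyclotomic polynomial
  have hmin : minpoly ℚ ζ = map (Int.castRingHom ℚ) (cyclotomic m ℤ) := by
    rw [map_cyclotomic_int, cyclotomic_eq_minpoly_rat hζ hm]
  have hder : aeval ζ (derivative (minpoly ℚ ζ)) = aeval ζ (derivative (cyclotomic m ℤ)) := by
    rw [hmin, derivative_map, ← algebraMap_int_eq, aeval_map_algebraMap]
  -- differentiate `X^m - 1 = Φ_m * Q` and evaluate at `ζ`
  have hΦ : aeval ζ (cyclotomic m ℤ) = 0 := by
    have h0 := minpoly.aeval ℚ ζ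
    rwa [hmin, ← algebraMap_int_eq, aeval_map_algebraMap] at h0
  have hD : derivative (X ^ m - 1 : ℤ[X]) = derivative (cyclotomic m ℤ) * Q + cyclotomic m ℤ * derivative Q := by
    rw [hQ, derivative_mul]
  have hD' : (m : K) * ζ ^ (m - 1) = aeval ζ (derivative (cyclotomic m ℤ)) * aeval ζ Q := by
    have := congr_arg (aeval ζ) hD
    simp only [derivative_sub, derivative_X_pow, derivative_one, sub_zero, map_mul, map_natCast,
      map_pow, aeval_X, map_add, hΦ, zero_mul, add_zero] at this
    simpa using this
  refine ⟨aeval ζ Q * ζ, ?_, ?_⟩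
  · exact Subalgebra.mul_mem _ (Polynomial.aeval_mem_adjoin_singleton ℤ ζ)
      (Algebra.self_mem_adjoin_singleton ℤ ζ)
  · rw [hder, ← mul_assoc, ← hD', mul_assoc, ← pow_succ, Nat.sub_add_cancel hm, hζ.pow_eq_one,
      mul_one]

/-- `Φ_m′(ζ) ≠ 0` (separability; here from `m = Φ_m′(ζ)·q` and `m ≠ 0`). [folklore] -/
theorem aeval_derivative_minpoly_ne_zero {K : Type*} [Field K] [CharZero K]
    {ζ : K} (hζ : IsPrimitiveRoot ζ m) :
    aeval ζ (derivative (minpoly ℚ ζ)) ≠ 0 := by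
  obtain ⟨q, -, hq⟩ := exists_natCast_eq_aeval_derivative_mul m hζ
  intro h
  rw [h, zero_mul] at hq
  exact (NeZero.ne m) (by exact_mod_cast hq)

/-! ### §2 `m·ℤ[ζ]^∨ ⊆ ℤ[ζ]` (the trace dual over `ℚ`) -/

/-- **`m·ℤ[ζ_m]^∨ ⊆ ℤ[ζ_m]`**: if `y ∈ ℚ(ζ_m)` has `Tr_{ℚ(ζ_m)/ℚ}(y·z) ∈ ℤ` for every `z ∈ ℤ[ζ_m]`,
then `m·y ∈ ℤ[ζ_m]`.  Mathlib's `traceForm_dualSubmodule_adjoin` (`ℤ[ζ]^∨ = Φ_m′(ζ)⁻¹·ℤ[ζ]`,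
Euler) and §1. [folklore] -/
theorem exists_natCast_mul_eq_of_forall_trace_mul_mem {K : Type*} [Field K] [NumberField K]
    [IsCyclotomicExtension {m} ℚ K] {ζ : K} (hζ : IsPrimitiveRoot ζ m) {y : K}
    (hy : ∀ z ∈ Algebra.adjoin ℤ {ζ}, ∃ n : ℤ, (n : ℚ) = Algebra.trace ℚ K (y * z)) :
    ∃ z ∈ Algebra.adjoin ℤ {ζ}, (m : K) * y = z := by
  have hm : 0 < m := Nat.pos_of_ne_zero (NeZero.ne m)
  have htop : Algebra.adjoin ℚ {ζ} = ⊤ := IsCyclotomicExtension.adjoin_primitive_root_eq_top hζ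
  have hint : IsIntegral ℤ ζ := hζ.isIntegral hm
  have hdual := traceForm_dualSubmodule_adjoin ℤ ℚ (L := K) htop hint
  have hmem : y ∈ (Algebra.traceForm ℚ K).dualSubmodule
      (Subalgebra.toSubmodule (Algebra.adjoin ℤ {ζ})) := by
    rw [LinearMap.BilinForm.mem_dualSubmodule]
    intro z hz
    obtain ⟨n, hn⟩ := hy z hz
    rw [Algebra.traceForm_apply, Submodule.mem_one]
    exact ⟨n, by simpa using hn⟩
  rw [hdual, Submodule.mem_smul_pointwise_iff_exists] at hmem
  obtain ⟨z, hz, rfl⟩ := hmem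
  obtain ⟨q, hq, hmq⟩ := exists_natCast_eq_aeval_derivative_mul m hζ
  have hne := aeval_derivative_minpoly_ne_zero m hζ
  refine ⟨q * z, Subalgebra.mul_mem _ hq hz, ?_⟩
  rw [hmq, smul_eq_mul, mul_assoc, mul_left_comm, mul_inv_cancel_left₀ hne]


/-- **`ℤ[ζ] = ℤ⟨ζ^i : i < φ(m)⟩`** as a `ℤ`-module, on the power basis of `ℚ(ζ_m)/ℚ` generated by `ζ`
(Mathlib's argument in `traceForm_dualSubmodule_adjoin`). [folklore] -/
theorem toSubmodule_adjoin_eq_span_range_basis {K : Type*} [Field K] [NumberField K]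
    [IsCyclotomicExtension {m} ℚ K] {ζ : K} (hζ : IsPrimitiveRoot ζ m) :
    Subalgebra.toSubmodule (Algebra.adjoin ℤ {ζ}) =
      Submodule.span ℤ (Set.range (IsPrimitiveRoot.powerBasis ℚ hζ).basis) := by
  have hm : 0 < m := Nat.pos_of_ne_zero (NeZero.ne m)
  have hint : IsIntegral ℤ ζ := hζ.isIntegral hm
  set pb := IsPrimitiveRoot.powerBasis ℚ hζ with hpb
  have hgen : pb.gen = ζ := IsPrimitiveRoot.powerBasis_gen ℚ hζ
  rw [← Submodule.span_range_natDegree_eq_adjoin (minpoly.monic hint) (minpoly.aeval _ _)]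
  congr; ext y
  have hdeg : natDegree (minpoly ℤ ζ) = pb.dim := by
    rw [← pb.natDegree_minpoly, hgen, minpoly.isIntegrallyClosed_eq_field_fractions' ℚ hint,
      (minpoly.monic hint).natDegree_map]
  simp only [Finset.coe_image, Finset.coe_range, Set.mem_image, Set.mem_Iio, Set.mem_range,
    pb.basis_eq_pow, hgen, hdeg]
  exact ⟨fun ⟨a, b, c⟩ ↦ ⟨⟨a, b⟩, c⟩, fun ⟨⟨a, b⟩, c⟩ ↦ ⟨a, b, c⟩⟩

/-- **The trace-dual basis vectors `d_i` of the power basis `{ζ^i}` have `m·d_i ∈ ℤ[ζ]`**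
(they lie in `ℤ[ζ]^∨`; §2). [folklore] -/
theorem exists_natCast_mul_traceDual_eq {K : Type*} [Field K] [NumberField K]
    [IsCyclotomicExtension {m} ℚ K] {ζ : K} (hζ : IsPrimitiveRoot ζ m)
    (i : Fin (IsPrimitiveRoot.powerBasis ℚ hζ).dim) :
    ∃ z ∈ Algebra.adjoin ℤ {ζ},
      (m : K) * (IsPrimitiveRoot.powerBasis ℚ hζ).basis.traceDual i = z := by
  classical
  refine exists_natCast_mul_eq_of_forall_trace_mul_mem m hζ fun z hz => ?_
  have hmem : (IsPrimitiveRoot.powerBasis ℚ hζ).basis.traceDual i ∈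
      (Algebra.traceForm ℚ K).dualSubmodule (Subalgebra.toSubmodule (Algebra.adjoin ℤ {ζ})) := by
    rw [toSubmodule_adjoin_eq_span_range_basis m hζ,
      LinearMap.BilinForm.dualSubmodule_span_of_basis _ (traceForm_nondegenerate ℚ K),
      Module.Basis.traceDual_def]
    exact Submodule.subset_span ⟨i, rfl⟩
  rw [LinearMap.BilinForm.mem_dualSubmodule] at hmem
  obtain ⟨n, hn⟩ := (Submodule.mem_one).mp (hmem z hz)
  exact ⟨n, by simpa [Algebra.traceForm_apply] using hn⟩

/-! ### §3 The semi-local lattice `L_int′(m) ⊂ ℚ_p ⊗ ℚ(ζ_m)` is self-dual for the trace (`p ∤ m`) -/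

variable (p : ℕ) [Fact p.Prime]

/-- **`m·L_int′(m)^∨ ⊆ L_int′(m)`** (any `m`): if `a ∈ ℚ_p ⊗ ℚ(ζ_m)` has
`‖Tr_{(ℚ_p ⊗ ℚ(ζ_m))/ℚ_p}(a·(1 ⊗ b))‖ ≤ 1` for every `b ∈ 𝓞_{ℚ(ζ_m)}`, then `m·a ∈ L_int′(m)`.
Proof: expand `a` in the base change `1 ⊗ d_i` of the trace-dual basis of the power basis — the
coordinates are the traces `Tr(a·(1 ⊗ ζ^i)) ∈ ℤ_p` — and use `m·d_i ∈ ℤ[ζ] ⊆ 𝓞`.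
[cite: Kim2022StructureSelmer, §3.4.1 (the lattice `ℤ_p ⊗ 𝓞` of the semi-local `exp*`)] -/
theorem natCast_smul_mem_span_ringOfIntegers_of_norm_trace_mul_le_one
    {a : ℚ_[p] ⊗[ℚ] CyclotomicField m ℚ}
    (ha : ∀ b : 𝓞 (CyclotomicField m ℚ),
      ‖Algebra.trace ℚ_[p] (ℚ_[p] ⊗[ℚ] CyclotomicField m ℚ)
          (a * ((1 : ℚ_[p]) ⊗ₜ[ℚ] (b : CyclotomicField m ℚ)))‖ ≤ 1) :
    (m : ℚ_[p]) • a ∈ Submodule.span ℤ_[p]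
      (Set.range fun b : 𝓞 (CyclotomicField m ℚ) ↦ (1 : ℚ_[p]) ⊗ₜ[ℚ] (b : CyclotomicField m ℚ)) := by
  classical
  have hm : 0 < m := Nat.pos_of_ne_zero (NeZero.ne m)
  have hζ := IsCyclotomicExtension.zeta_spec m ℚ (CyclotomicField m ℚ)
  set ζ := IsCyclotomicExtension.zeta m ℚ (CyclotomicField m ℚ) with hζdef
  set pb : PowerBasis ℚ (CyclotomicField m ℚ) := IsPrimitiveRoot.powerBasis ℚ hζ with hpb
  have hgen : pb.gen = ζ := IsPrimitiveRoot.powerBasis_gen ℚ hζ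
  set d : Module.Basis (Fin pb.dim) ℚ (CyclotomicField m ℚ) := pb.basis.traceDual with hd
  set f : Module.Basis (Fin pb.dim) ℚ_[p] (ℚ_[p] ⊗[ℚ] CyclotomicField m ℚ) :=
    Algebra.TensorProduct.basis ℚ_[p] d with hf
  -- the coordinates of `a` in the basis `f = 1 ⊗ d` are the traces against `1 ⊗ ζ^i`
  have htr : ∀ i j : Fin pb.dim,
      Algebra.trace ℚ_[p] (ℚ_[p] ⊗[ℚ] CyclotomicField m ℚ) (f j * ((1 : ℚ_[p]) ⊗ₜ[ℚ] (ζ ^ (i : ℕ)))) =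
        if i = j then 1 else 0 := by
    intro i j
    rw [hf, Algebra.TensorProduct.basis_apply, Algebra.TensorProduct.tmul_mul_tmul, one_mul,
      trace_one_tmul, hd]
    have hb : ζ ^ (i : ℕ) = pb.basis i := by rw [pb.coe_basis, hgen]
    rw [hb, Module.Basis.trace_traceDual_mul]
    split_ifs <;> simp
  have hcoord : ∀ i : Fin pb.dim, f.repr a i =
      Algebra.trace ℚ_[p] (ℚ_[p] ⊗[ℚ] CyclotomicField m ℚ) (a * ((1 : ℚ_[p]) ⊗ₜ[ℚ] (ζ ^ (i : ℕ)))) := by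
    intro i
    conv_rhs => rw [← f.sum_repr a]
    rw [Finset.sum_mul, map_sum]
    simp_rw [smul_mul_assoc, map_smul, htr, smul_eq_mul, mul_ite, mul_one, mul_zero]
    rw [Finset.sum_ite_eq]
    simp
  -- `m • (1 ⊗ d_i) = 1 ⊗ (m·d_i)` lies in `L_int′(m)`
  have hmf : ∀ i : Fin pb.dim, (m : ℚ_[p]) • f i ∈ Submodule.span ℤ_[p]
      (Set.range fun b : 𝓞 (CyclotomicField m ℚ) ↦ (1 : ℚ_[p]) ⊗ₜ[ℚ] (b : CyclotomicField m ℚ)) := by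
    intro i
    obtain ⟨z, hz, hzeq⟩ := exists_natCast_mul_traceDual_eq m hζ i
    have hzint : z ∈ integralClosure ℤ (CyclotomicField m ℚ) :=
      adjoin_le_integralClosure (hζ.isIntegral hm) hz
    refine Submodule.subset_span ⟨⟨z, hzint⟩, ?_⟩
    change (1 : ℚ_[p]) ⊗ₜ[ℚ] z = (m : ℚ_[p]) • f i
    have hdi : d i = (IsPrimitiveRoot.powerBasis ℚ hζ).basis.traceDual i := rfl
    rw [hf, Algebra.TensorProduct.basis_apply, ← hzeq, ← hdi,
      show (m : ℚ_[p]) = algebraMap ℚ ℚ_[p] (m : ℚ) by simp, IsScalarTower.algebraMap_smul,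
      ← TensorProduct.tmul_smul, Algebra.smul_def, map_natCast]
  -- assemble
  rw [← f.sum_repr a, Finset.smul_sum]
  refine Submodule.sum_mem _ fun i _ => ?_
  rw [smul_comm]
  obtain ⟨r, hr⟩ := exists_padicInt_coe_eq_of_norm_le_one (p := p) (x := f.repr a i) (by
    rw [hcoord]
    have hζi : ζ ^ (i : ℕ) ∈ integralClosure ℤ (CyclotomicField m ℚ) :=
      (mem_integralClosure_iff ℤ (CyclotomicField m ℚ)).mpr ((hζ.isIntegral hm).pow _)
    exact ha ⟨ζ ^ (i : ℕ), hζi⟩)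
  rw [← hr, ← padicInt_smul_eq_coe_smul]
  exact Submodule.smul_mem _ r (hmf i)

/-- ★ **Self-duality of `L_int′(m)` for `p ∤ m` (the "`⊇`" half)**: an element `a ∈ ℚ_p ⊗ ℚ(ζ_m)` whose
traces against `1 ⊗ 𝓞_{ℚ(ζ_m)}` are `p`-adic integers lies in `L_int′(m) = ℤ_p⟨1 ⊗ 𝓞_{ℚ(ζ_m)}⟩`
(`m ∈ ℤ_pˣ`).  With seat w2-acc4's `norm_trace_le_one_of_mem_span_ringOfIntegers` (the "`⊆`" half)
this says `L_int′(m)^∨ = L_int′(m)`: the semi-local integer ring `∏_{w∣p} 𝒪_w` is its own trace dual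
(`ℚ(ζ_m)` is unramified at `p`).
[cite: Kim2022StructureSelmer, §3.4.1 and the proof of Thm. 3.13 (arXiv v3 pp. 26–27)] -/
theorem mem_span_ringOfIntegers_of_norm_trace_mul_le_one (hpm : ¬ p ∣ m)
    {a : ℚ_[p] ⊗[ℚ] CyclotomicField m ℚ}
    (ha : ∀ b : 𝓞 (CyclotomicField m ℚ),
      ‖Algebra.trace ℚ_[p] (ℚ_[p] ⊗[ℚ] CyclotomicField m ℚ)
          (a * ((1 : ℚ_[p]) ⊗ₜ[ℚ] (b : CyclotomicField m ℚ)))‖ ≤ 1) :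
    a ∈ Submodule.span ℤ_[p]
      (Set.range fun b : 𝓞 (CyclotomicField m ℚ) ↦ (1 : ℚ_[p]) ⊗ₜ[ℚ] (b : CyclotomicField m ℚ)) := by
  have hma := natCast_smul_mem_span_ringOfIntegers_of_norm_trace_mul_le_one m p ha
  -- `m` is a `p`-adic unit
  have hnorm : ‖((m : ℤ) : ℤ_[p])‖ = 1 := by
    refine le_antisymm (PadicInt.norm_le_one _) (not_lt.mp fun hlt => hpm ?_)
    have := (PadicInt.norm_int_lt_one_iff_dvd (p := p) (m : ℤ)).mp hlt
    exact_mod_cast this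
  have hunit : IsUnit ((m : ℤ) : ℤ_[p]) := PadicInt.isUnit_iff.mpr hnorm
  obtain ⟨u, hu⟩ := hunit
  have hma' : (u : ℤ_[p]) • a ∈ Submodule.span ℤ_[p]
      (Set.range fun b : 𝓞 (CyclotomicField m ℚ) ↦ (1 : ℚ_[p]) ⊗ₜ[ℚ] (b : CyclotomicField m ℚ)) := by
    rw [hu, padicInt_smul_eq_coe_smul]
    simpa using hma
  have := Submodule.smul_mem _ (↑u⁻¹ : ℤ_[p]) hma'
  rwa [smul_smul, Units.inv_mul, one_smul] at this

/-- **`L_int′(m)^∨ = L_int′(m)` (`p ∤ m`)**, as an `iff` on elements: `a ∈ L_int′(m)` iff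
`‖Tr(a·l)‖ ≤ 1` for every `l ∈ L_int′(m)` (⇒: w2-acc4's `mul_mem_span_ringOfIntegers` +
`norm_trace_le_one_of_mem_span_ringOfIntegers`; ⇐: the ★ theorem).
[cite: Kim2022StructureSelmer, §3.4.1 and the proof of Thm. 3.13 (arXiv v3 pp. 26–27)] -/
theorem mem_span_ringOfIntegers_iff_forall_norm_trace_mul_le_one (hpm : ¬ p ∣ m)
    (a : ℚ_[p] ⊗[ℚ] CyclotomicField m ℚ) :
    a ∈ Submodule.span ℤ_[p]
      (Set.range fun b : 𝓞 (CyclotomicField m ℚ) ↦ (1 : ℚ_[p]) ⊗ₜ[ℚ] (b : CyclotomicField m ℚ)) ↔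
    ∀ l ∈ Submodule.span ℤ_[p]
      (Set.range fun b : 𝓞 (CyclotomicField m ℚ) ↦ (1 : ℚ_[p]) ⊗ₜ[ℚ] (b : CyclotomicField m ℚ)),
      ‖Algebra.trace ℚ_[p] (ℚ_[p] ⊗[ℚ] CyclotomicField m ℚ) (a * l)‖ ≤ 1 := by
  constructor
  · intro ha l hl
    exact KimAtThreeFineKatoSemiLocalLatticeInt.norm_trace_le_one_of_mem_span_ringOfIntegers p m
      (KimAtThreeFineKatoSemiLocalLatticeInt.mul_mem_span_ringOfIntegers p m ha hl)
  · intro h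
    exact mem_span_ringOfIntegers_of_norm_trace_mul_le_one m p hpm fun b =>
      h _ (Submodule.subset_span ⟨b, rfl⟩)

/-! ### §4 Per-factor form: local trace duals land in `L_int′(m)` under w2-acc4's `Ψ⁻¹` -/

/-- **Per-factor form of self-duality** (the shape the semi-local `exp*` consumers use): for seat
w2-acc4's `ℚ`-algebra isomorphism `Ψ : ℚ_p ⊗ ℚ(ζ_m) ≃ ∏_{w ∣ p} ℚ(ζ_m)_w` (pure-tensor formula `hΨ`,
`Literature.NumberTheory.AdelicBaseChange.exists_padicTensorAlgEquiv`) and `p ∤ m`, a family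
`y = (y_w)_w` with every `y_w` in the TRACE DUAL of `𝒪_w` (`Tr_{L_w/ℚ_v}(y_w·o) ∈ 𝒪_v` for all
`o ∈ 𝒪_w`) has `Ψ⁻¹ y ∈ L_int′(m)` — hence (w2-acc4's INTO direction) every `y_w ∈ 𝒪_w`: the
unramified completions `ℚ(ζ_m)_w`, `w ∣ p ∤ m`, have `𝒪_w^∨ = 𝒪_w`.  (`Tr = Σ_w Tr_w ∘ Ψ` is w2-acc4's
`padicTensor_trace`; `Ψ(1 ⊗ 𝓞) ⊆ ∏ 𝒪_w` their `padicTensor_tmul_mem_adicCompletionIntegers`.)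
[cite: CasselsFrohlichANT1967, Ch. II §10 Theorem (10.2) and §11] -/
theorem symm_mem_span_ringOfIntegers_of_forall_trace_mul_mem (hpm : ¬ p ∣ m)
    [Fintype (((Rat.HeightOneSpectrum.primesEquiv (R := 𝓞 ℚ)).symm ⟨p, Fact.out⟩).Extension
      (𝓞 (CyclotomicField m ℚ)))]
    (Ψ : ℚ_[p] ⊗[ℚ] CyclotomicField m ℚ ≃ₐ[ℚ]
      (Π w : ((Rat.HeightOneSpectrum.primesEquiv (R := 𝓞 ℚ)).symm ⟨p, Fact.out⟩).Extension
        (𝓞 (CyclotomicField m ℚ)), w.1.adicCompletion (CyclotomicField m ℚ)))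
    (hΨ : ∀ (s : ℚ_[p]) (x : CyclotomicField m ℚ)
      (w : ((Rat.HeightOneSpectrum.primesEquiv (R := 𝓞 ℚ)).symm ⟨p, Fact.out⟩).Extension
        (𝓞 (CyclotomicField m ℚ))),
      Ψ (s ⊗ₜ[ℚ] x) w = algebraMap (CyclotomicField m ℚ) (w.1.adicCompletion (CyclotomicField m ℚ)) x *
        algebraMap (((Rat.HeightOneSpectrum.primesEquiv (R := 𝓞 ℚ)).symm ⟨p, Fact.out⟩).adicCompletion ℚ)
          (w.1.adicCompletion (CyclotomicField m ℚ)) (Padic.adicCompletionEquiv (𝓞 ℚ) ⟨p, Fact.out⟩ s))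
    (y : Π w : ((Rat.HeightOneSpectrum.primesEquiv (R := 𝓞 ℚ)).symm ⟨p, Fact.out⟩).Extension
        (𝓞 (CyclotomicField m ℚ)), w.1.adicCompletion (CyclotomicField m ℚ))
    (hy : ∀ w, ∀ o ∈ w.1.adicCompletionIntegers (CyclotomicField m ℚ),
      Algebra.trace (((Rat.HeightOneSpectrum.primesEquiv (R := 𝓞 ℚ)).symm ⟨p, Fact.out⟩).adicCompletion ℚ)
          (w.1.adicCompletion (CyclotomicField m ℚ)) (y w * o) ∈
        (((Rat.HeightOneSpectrum.primesEquiv (R := 𝓞 ℚ)).symm ⟨p, Fact.out⟩).adicCompletionIntegers ℚ)) :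
    Ψ.symm y ∈ Submodule.span ℤ_[p]
      (Set.range fun b : 𝓞 (CyclotomicField m ℚ) ↦ (1 : ℚ_[p]) ⊗ₜ[ℚ] (b : CyclotomicField m ℚ)) := by
  refine mem_span_ringOfIntegers_of_norm_trace_mul_le_one m p hpm fun b => ?_
  set t := Algebra.trace ℚ_[p] (ℚ_[p] ⊗[ℚ] CyclotomicField m ℚ)
    (Ψ.symm y * ((1 : ℚ_[p]) ⊗ₜ[ℚ] (b : CyclotomicField m ℚ))) with ht
  -- `e_p(t) = Σ_w Tr_w(y_w · Ψ(1 ⊗ b)_w) ∈ 𝒪_v`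
  have het : Padic.adicCompletionEquiv (𝓞 ℚ) ⟨p, Fact.out⟩ t ∈
      (((Rat.HeightOneSpectrum.primesEquiv (R := 𝓞 ℚ)).symm ⟨p, Fact.out⟩).adicCompletionIntegers ℚ) := by
    rw [ht, Literature.NumberTheory.AdelicBaseChange.padicTensor_trace Ψ hΨ, map_mul,
      AlgEquiv.apply_symm_apply]
    refine Subring.sum_mem _ fun w _ => ?_
    rw [Pi.mul_apply]
    refine hy w _ ?_
    have h := Literature.NumberTheory.AdelicBaseChange.padicTensor_tmul_mem_adicCompletionIntegers
      (Ψ : ℚ_[p] ⊗[ℚ] CyclotomicField m ℚ →ₐ[ℚ] _) hΨ 1 b w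
    rwa [PadicInt.coe_one] at h
  -- hence `t ∈ ℤ_p`
  have hts : t = ((PadicInt.adicCompletionIntegersEquiv (𝓞 ℚ) ⟨p, Fact.out⟩).symm
      ⟨_, het⟩ : ℤ_[p]) := by
    rw [PadicInt.coe_adicCompletionIntegersEquiv_symm_apply]
    exact ((Padic.adicCompletionEquiv (𝓞 ℚ) ⟨p, Fact.out⟩).symm_apply_apply t).symm
  rw [hts]
  exact PadicInt.norm_le_one _

end Summit.BirchSwinnertonDyer.BirchSwinnertonDyer.Theorems.KimAtThreeSemiLocalTraceDual

end
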